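import Summits.ValiantsHypothesis.ValiantsHypothesis.Theorems.LacunarySymmetroidMatrixDescartesDefectLaw
import Summits.ValiantsHypothesis.ValiantsHypothesis.Theorems.LacunarySymmetroidMatrixDescartesRangeObligations

/-!
# `MatrixDescartes` — line «defect» ported (2/·): the PENCIL DEFECT LAW `… ≤ m!(Kh)^m`, the pigeonhole CENSUS ROWS at
# `(2,6)/(2,7)/(2,8)/(2,9)` (letters ≥ 14/5 · 45/14 · 293/85/22/5 · 1981/543/130/29/6 for defect `D = 1, 2, …`) and the
# EXCESS LAW `Z₊ ≤ 2·log₂(‖f‖₁/√|c₀lc|) + D(1 + 2log₂ D)`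

HONEST FRAMING.  Port (val-lit desk g11 pool; porter val-port-1) of §5–§7 of the crux workfile
`Cruxes/MatrixDescartes/Lines/defect.lean` v2.1 (val-idea-6 g4, LINE 3; val-idea-crit-1 VERDICT #25 = PASS, structure +
instrument tier, 0 seats; rows reproduced exactly by the critic, `H + 1` fails to certify).  The crux
`Summit.ValiantsHypothesis.ValiantsHypothesis.Theses.LacunarySymmetroid.MatrixDescartes` (`stmt-ValiantsHypothesis-18050`) is
asymptotic in `K` and HEIGHT-FREE; these are height-sensitive INSTRUMENT rows for the engines' near-full `(2,K)` searches
(B⁻ register) and do not bear on the crux, on Conjecture B at `m = 2`, or on `VP ≠ VNP`.  Vocabulary by name: `pencil`,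
`l1`, `Rrep` (`…FiniteSectorDefs` / `…FiniteSectorHeightDefs`); `‖det P‖₁ ≤ m!(Kh)^m` is CITED as
`…RangeObligations.l1_det_pencil_le` (val-port-4; built on `…ProfileLaw.abs_coeff_det_pencil_le`, crit-1 #25 port note «share
the Rrep/pencil/coeff-bound module with profile»), `defectLaw` from `…DefectLaw`.  The workfile's local copies of `pencil`/`Rrep`/`pencil_apply`/`prod_pencil_apply`/
`coeff_prod_pencil`/`abs_coeff_det_pencil_le` are NOT re-declared.  No `Theses` import.

* **§5 pencils** (`pencilDefectLaw`): the defect law with right side `m!(Kh)^m` — ANY `m`, symmetric or not (the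
  workfile's `sum_Rrep_le` / `l1_det_pencil_le` are the tree's `…RangeObligations.sum_range_Rrep_le` / `.l1_det_pencil_le`).
* **§6 rational minorant and rows** (`row_core`, `row2`; `defectRow_8_26_1…4`, `defectRow_9_32_1…5`, `defectRow_6_16_1/2`,
  `defectRow_7_20_1/2`; `m = 2`, ends integer-normalised `|c₀·lc| ≥ 1`, each a closed theorem `… → False` by `norm_num` on
  an exact rational certificate `φ`):
  `(2,8)`, `Z = 26` (the 26-hunt): degree 27 ⇒ letter ≥ 293 · 28 ⇒ ≥ 85 · 29 ⇒ ≥ 22 · 30 ⇒ ≥ 5;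
  `(2,9)`, `Z = 32`: degree 33 ⇒ ≥ 1981 · 34 ⇒ ≥ 543 · 35 ⇒ ≥ 130 · 36 ⇒ ≥ 29 · 37 ⇒ ≥ 6;
  `(2,6)`, `Z = 16`: 17 ⇒ ≥ 14 · 18 ⇒ ≥ 5;  `(2,7)`, `Z = 20`: 21 ⇒ ≥ 45 · 22 ⇒ ≥ 14
  (full case `D = 0`: `≥ 31 / 104 / 725 / 5149` by «range», `…Range.heightStampLaw_G6/G7/G8/G9`; the interpolation rows of
  §9, sharper for `D ≥ 3`, follow in the §8–§10 port files with the positive `NearFullHeightRow` packaging).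
* **§7 the excess law** (`excessLaw`, pigeonhole constant): `√|c₀·lc| · √2^Z · (√2·D)^{−D} ≤ ‖f‖₁`.
[folklore] throughout (permutation expansion, Taylor minorants `2 − φ²/4 ≤ 2cos(φ/2)`, `x − x³/6 ≤ sin x`, arithmetic).
-/

-- `Summit.ValiantsHypothesis.ValiantsHypothesis.…` repeats a component by the D-0017 layout
-- (single-conjunct summit), which the `dupNamespace` linter flags; the name is mandated.
set_option linter.dupNamespace false

noncomputable section

open Polynomial Finset

namespace Summit.ValiantsHypothesis.ValiantsHypothesis.Theorems.LacunarySymmetroidMatrixDescartes.Defect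

open Summit.ValiantsHypothesis.ValiantsHypothesis.Theorems.LacunarySymmetroidMatrixDescartes.FiniteSector
open Summit.ValiantsHypothesis.ValiantsHypothesis.Theorems.LacunarySymmetroidMatrixDescartes.RangeObligations
  (l1_det_pencil_le)

/-! ## §5 Pencils: the defect law with right side `m!(Kh)^m` (`‖det P‖₁ ≤ m!(Kh)^m` is the tree's
`…RangeObligations.l1_det_pencil_le`, val-port-4, over `…ProfileLaw.abs_coeff_det_pencil_le`; not re-declared) -/

/-- **Pencil defect law.**  Letters `≤ h`, `A` distinct positive roots of `det P ≠ 0`, defect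
`D = deg − |A| ≥ 1`: `√|c₀·lc| · (2cos(φ/2))^{|A|} · (sin(φ/D)/√2)^D ≤ m!(Kh)^m` for all `0 < φ ≤ π/2` — ANY `m`,
symmetric or not (the workfile's `0 ≤ h` binder is dropped: the tree's `l1_det_pencil_le` needs no sign). [folklore] -/
theorem pencilDefectLaw {m K : ℕ} (d : Fin K → ℕ) (S : Fin K → Matrix (Fin m) (Fin m) ℝ) {h : ℝ}
    (hS : ∀ l i j, |S l i j| ≤ h) (hdet : (pencil d S).det ≠ 0)
    (A : Finset ℝ) (hApos : ∀ a ∈ A, 0 < a) (hAroot : ∀ a ∈ A, (pencil d S).det.IsRoot a)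
    {D : ℕ} (hD : (pencil d S).det.natDegree = A.card + D) (hD1 : 1 ≤ D)
    {φ : ℝ} (hφ0 : 0 < φ) (hφ : φ ≤ Real.pi / 2) :
    Real.sqrt |(pencil d S).det.coeff 0 * (pencil d S).det.leadingCoeff|
      * ((2 * Real.cos (φ / 2)) ^ A.card * (Real.sin (φ / D) / Real.sqrt 2) ^ D)
      ≤ (m.factorial : ℝ) * (K * h) ^ m :=
  (defectLaw _ hdet A hApos hAroot hD hD1 hφ0 hφ).trans (l1_det_pencil_le d S hS)

/-! ## §6 Rational minorant and census ROWS (`m = 2`; integer-normalised ends `|c₀·lc| ≥ 1`) -/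

/-- Squared rational minorant of the defect law: with `c₁ = 2 − φ²/4 ≤ 2cos(φ/2)` and
`s₁ = φ/D − (φ/D)³/6 ≤ sin(φ/D)` (Taylor), `E ≥ 1`:  `c₁^{2Z} (s₁²/2)^D ≤ R²`. [folklore] -/
theorem row_core {Z D : ℕ} (hD1 : 1 ≤ D) {φ E R : ℝ} (hφ0 : 0 < φ) (hφ1 : φ ≤ 3 / 2) (hE : 1 ≤ E)
    (hlaw : Real.sqrt E * ((2 * Real.cos (φ / 2)) ^ Z * (Real.sin (φ / D) / Real.sqrt 2) ^ D) ≤ R) :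
    (2 - φ ^ 2 / 4) ^ (2 * Z) * (((φ / D - (φ / D) ^ 3 / 6) ^ 2) / 2) ^ D ≤ R ^ 2 := by
  have hD' : (0 : ℝ) < D := by exact_mod_cast hD1
  set c := 2 - φ ^ 2 / 4 with hc
  set x := φ / D with hx
  set s := x - x ^ 3 / 6 with hs
  have hx0 : 0 < x := by positivity
  have hx1 : x ≤ 3 / 2 := by
    calc x = φ / D := rfl
      _ ≤ φ / 1 := div_le_div_of_nonneg_left hφ0.le one_pos (by exact_mod_cast hD1)
      _ ≤ 3 / 2 := by rw [div_one]; exact hφ1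
  have hc0 : 0 ≤ c := by rw [hc]; nlinarith
  have hcle : c ≤ 2 * Real.cos (φ / 2) := by
    have := Real.one_sub_sq_div_two_le_cos (x := φ / 2)
    rw [hc]; nlinarith
  have hs0 : 0 ≤ s := by
    have hx2 : x ^ 2 ≤ 9 / 4 := by nlinarith
    have h3 : x ^ 3 / 6 ≤ x := by
      have : x ^ 3 = x * x ^ 2 := by ring
      rw [this]
      nlinarith [mul_le_mul_of_nonneg_left hx2 hx0.le]
    rw [hs]; linarith
  have hsle : s ≤ Real.sin x := by rw [hs]; exact (Real.sin_gt_sub_cube hx0).le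
  have hsq2 : (0 : ℝ) < Real.sqrt 2 := by positivity
  -- L₀ ≤ law LHS ≤ R
  have hL0 : c ^ Z * (s / Real.sqrt 2) ^ D
      ≤ Real.sqrt E * ((2 * Real.cos (φ / 2)) ^ Z * (Real.sin (φ / D) / Real.sqrt 2) ^ D) := by
    have h1 : c ^ Z ≤ (2 * Real.cos (φ / 2)) ^ Z := pow_le_pow_left₀ hc0 hcle Z
    have h2 : (s / Real.sqrt 2) ^ D ≤ (Real.sin (φ / D) / Real.sqrt 2) ^ D :=
      pow_le_pow_left₀ (by positivity) (div_le_div_of_nonneg_right hsle hsq2.le) D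
    have h3 : (1 : ℝ) ≤ Real.sqrt E := by
      rw [show (1 : ℝ) = Real.sqrt 1 by simp]; exact Real.sqrt_le_sqrt hE
    have h4 : 0 ≤ (2 * Real.cos (φ / 2)) ^ Z := pow_nonneg (hc0.trans hcle) Z
    calc c ^ Z * (s / Real.sqrt 2) ^ D = 1 * (c ^ Z * (s / Real.sqrt 2) ^ D) := (one_mul _).symm
      _ ≤ Real.sqrt E * ((2 * Real.cos (φ / 2)) ^ Z * (Real.sin (φ / D) / Real.sqrt 2) ^ D) :=
          mul_le_mul h3 (mul_le_mul h1 h2 (by positivity) h4) (by positivity) (by positivity)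
  have hL0R : c ^ Z * (s / Real.sqrt 2) ^ D ≤ R := hL0.trans hlaw
  have hL00 : 0 ≤ c ^ Z * (s / Real.sqrt 2) ^ D := by positivity
  have hsq : (c ^ Z * (s / Real.sqrt 2) ^ D) ^ 2 = c ^ (2 * Z) * (s ^ 2 / 2) ^ D := by
    have h2 : (s / Real.sqrt 2) ^ 2 = s ^ 2 / 2 := by
      rw [div_pow, Real.sq_sqrt (by norm_num : (0:ℝ) ≤ 2)]
    rw [mul_pow, pow_right_comm c Z 2, pow_right_comm (s / Real.sqrt 2) D 2, h2, ← pow_mul]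
  rw [← hsq]
  exact pow_le_pow_left₀ hL00 hL0R 2

/-- GENERIC `2×2` ROW.  If the rational certificate `(2K²H²)² < c₁^{2Z}(s₁²/2)^D` holds at some rational
`0 < φ ≤ 3/2`, then NO pencil `Σ_{l<K} t^{d_l} S_l` of symmetric-or-not real `2×2` letters of height `≤ H`
with ends-normalisation `|c₀·lc| ≥ 1` (automatic for integer letters) has `Z` distinct positive roots and
degree exactly `Z + D` (the workfile's `0 ≤ H` binder is dropped, see `pencilDefectLaw`). [folklore] -/
theorem row2 {K Z D : ℕ} (hD1 : 1 ≤ D) (φ H : ℝ) (hφ0 : 0 < φ) (hφ1 : φ ≤ 3 / 2)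
    (hnum : (2 * ((K : ℝ) * H) ^ 2) ^ 2
      < (2 - φ ^ 2 / 4) ^ (2 * Z) * (((φ / D - (φ / D) ^ 3 / 6) ^ 2) / 2) ^ D)
    (d : Fin K → ℕ) (S : Fin K → Matrix (Fin 2) (Fin 2) ℝ) (hS : ∀ l i j, |S l i j| ≤ H)
    (A : Finset ℝ) (hA : A.card = Z) (hApos : ∀ a ∈ A, 0 < a)
    (hAroot : ∀ a ∈ A, (pencil d S).det.IsRoot a) (hdeg : (pencil d S).det.natDegree = Z + D)
    (hE : 1 ≤ |(pencil d S).det.coeff 0 * (pencil d S).det.leadingCoeff|) : False := by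
  have hdet : (pencil d S).det ≠ 0 := by
    intro h0; rw [h0, natDegree_zero] at hdeg; omega
  have hφ : φ ≤ Real.pi / 2 := by linarith [Real.pi_gt_three]
  have hlaw := pencilDefectLaw d S hS hdet A hApos hAroot (D := D) (by rw [hdeg, hA]) hD1 hφ0 hφ
  rw [hA] at hlaw
  have hlaw' : Real.sqrt |(pencil d S).det.coeff 0 * (pencil d S).det.leadingCoeff|
      * ((2 * Real.cos (φ / 2)) ^ Z * (Real.sin (φ / D) / Real.sqrt 2) ^ D) ≤ 2 * ((K : ℝ) * H) ^ 2 := by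
    have : ((Nat.factorial 2 : ℕ) : ℝ) = 2 := by norm_num [Nat.factorial]
    simpa [this] using hlaw
  have := row_core hD1 hφ0 hφ1 hE hlaw'
  linarith

/-! ### Rows for the 26-hunt at `(2,8)` (full case `D = 0`: letter `≥ 725` by line «range»):
degree 27 ⇒ letter ≥ 293 · degree 28 ⇒ ≥ 85 · degree 29 ⇒ ≥ 22 · degree 30 ⇒ ≥ 5 · degree ≥ 31: no constraint. -/

/-- `(2,8)`, `Z = 26`, `D = 1` (degree 27): letters `≤ 292` impossible; certificate `φ = 19/50`. [folklore] -/
theorem defectRow_8_26_1 (d : Fin 8 → ℕ) (S : Fin 8 → Matrix (Fin 2) (Fin 2) ℝ) (hS : ∀ l i j, |S l i j| ≤ 292)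
    (A : Finset ℝ) (hA : A.card = 26) (hApos : ∀ a ∈ A, 0 < a) (hAroot : ∀ a ∈ A, (pencil d S).det.IsRoot a)
    (hdeg : (pencil d S).det.natDegree = 27)
    (hE : 1 ≤ |(pencil d S).det.coeff 0 * (pencil d S).det.leadingCoeff|) : False :=
  row2 (K := 8) (Z := 26) (D := 1) le_rfl (19/50) 292 (by norm_num) (by norm_num)
    (by norm_num) d S hS A hA hApos hAroot hdeg hE

/-- `(2,8)`, `Z = 26`, `D = 2` (degree 28): letters `≤ 84` impossible; certificate `φ = 27/50`. [folklore] -/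
theorem defectRow_8_26_2 (d : Fin 8 → ℕ) (S : Fin 8 → Matrix (Fin 2) (Fin 2) ℝ) (hS : ∀ l i j, |S l i j| ≤ 84)
    (A : Finset ℝ) (hA : A.card = 26) (hApos : ∀ a ∈ A, 0 < a) (hAroot : ∀ a ∈ A, (pencil d S).det.IsRoot a)
    (hdeg : (pencil d S).det.natDegree = 28)
    (hE : 1 ≤ |(pencil d S).det.coeff 0 * (pencil d S).det.leadingCoeff|) : False :=
  row2 (K := 8) (Z := 26) (D := 2) (by norm_num) (27/50) 84 (by norm_num) (by norm_num)
    (by norm_num) d S hS A hA hApos hAroot hdeg hE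

/-- `(2,8)`, `Z = 26`, `D = 3` (degree 29): letters `≤ 21` impossible; certificate `φ = 13/20`. [folklore] -/
theorem defectRow_8_26_3 (d : Fin 8 → ℕ) (S : Fin 8 → Matrix (Fin 2) (Fin 2) ℝ) (hS : ∀ l i j, |S l i j| ≤ 21)
    (A : Finset ℝ) (hA : A.card = 26) (hApos : ∀ a ∈ A, 0 < a) (hAroot : ∀ a ∈ A, (pencil d S).det.IsRoot a)
    (hdeg : (pencil d S).det.natDegree = 29)
    (hE : 1 ≤ |(pencil d S).det.coeff 0 * (pencil d S).det.leadingCoeff|) : False :=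
  row2 (K := 8) (Z := 26) (D := 3) (by norm_num) (13/20) 21 (by norm_num) (by norm_num)
    (by norm_num) d S hS A hA hApos hAroot hdeg hE

/-- `(2,8)`, `Z = 26`, `D = 4` (degree 30): letters `≤ 4` impossible; certificate `φ = 3/4`. [folklore] -/
theorem defectRow_8_26_4 (d : Fin 8 → ℕ) (S : Fin 8 → Matrix (Fin 2) (Fin 2) ℝ) (hS : ∀ l i j, |S l i j| ≤ 4)
    (A : Finset ℝ) (hA : A.card = 26) (hApos : ∀ a ∈ A, 0 < a) (hAroot : ∀ a ∈ A, (pencil d S).det.IsRoot a)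
    (hdeg : (pencil d S).det.natDegree = 30)
    (hE : 1 ≤ |(pencil d S).det.coeff 0 * (pencil d S).det.leadingCoeff|) : False :=
  row2 (K := 8) (Z := 26) (D := 4) (by norm_num) (3/4) 4 (by norm_num) (by norm_num)
    (by norm_num) d S hS A hA hApos hAroot hdeg hE

/-! ### Rows at `(2,9)`, `Z = 32 = n(2,8)` (full: letter ≥ 5149 by «range»):
degree 33 ⇒ ≥ 1981 · 34 ⇒ ≥ 543 · 35 ⇒ ≥ 130 · 36 ⇒ ≥ 29 · 37 ⇒ ≥ 6. -/

/-- `(2,9)`, `Z = 32`, `D = 1` (degree 33): letters `≤ 1980` impossible; certificate `φ = 17/50`. [folklore] -/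
theorem defectRow_9_32_1 (d : Fin 9 → ℕ) (S : Fin 9 → Matrix (Fin 2) (Fin 2) ℝ) (hS : ∀ l i j, |S l i j| ≤ 1980)
    (A : Finset ℝ) (hA : A.card = 32) (hApos : ∀ a ∈ A, 0 < a) (hAroot : ∀ a ∈ A, (pencil d S).det.IsRoot a)
    (hdeg : (pencil d S).det.natDegree = 33)
    (hE : 1 ≤ |(pencil d S).det.coeff 0 * (pencil d S).det.leadingCoeff|) : False :=
  row2 (K := 9) (Z := 32) (D := 1) le_rfl (17/50) 1980 (by norm_num) (by norm_num)
    (by norm_num) d S hS A hA hApos hAroot hdeg hE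

/-- `(2,9)`, `Z = 32`, `D = 2` (degree 34): letters `≤ 542` impossible; certificate `φ = 12/25`. [folklore] -/
theorem defectRow_9_32_2 (d : Fin 9 → ℕ) (S : Fin 9 → Matrix (Fin 2) (Fin 2) ℝ) (hS : ∀ l i j, |S l i j| ≤ 542)
    (A : Finset ℝ) (hA : A.card = 32) (hApos : ∀ a ∈ A, 0 < a) (hAroot : ∀ a ∈ A, (pencil d S).det.IsRoot a)
    (hdeg : (pencil d S).det.natDegree = 34)
    (hE : 1 ≤ |(pencil d S).det.coeff 0 * (pencil d S).det.leadingCoeff|) : False :=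
  row2 (K := 9) (Z := 32) (D := 2) (by norm_num) (12/25) 542 (by norm_num) (by norm_num)
    (by norm_num) d S hS A hA hApos hAroot hdeg hE

/-- `(2,9)`, `Z = 32`, `D = 3` (degree 35): letters `≤ 129` impossible; certificate `φ = 3/5`. [folklore] -/
theorem defectRow_9_32_3 (d : Fin 9 → ℕ) (S : Fin 9 → Matrix (Fin 2) (Fin 2) ℝ) (hS : ∀ l i j, |S l i j| ≤ 129)
    (A : Finset ℝ) (hA : A.card = 32) (hApos : ∀ a ∈ A, 0 < a) (hAroot : ∀ a ∈ A, (pencil d S).det.IsRoot a)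
    (hdeg : (pencil d S).det.natDegree = 35)
    (hE : 1 ≤ |(pencil d S).det.coeff 0 * (pencil d S).det.leadingCoeff|) : False :=
  row2 (K := 9) (Z := 32) (D := 3) (by norm_num) (3/5) 129 (by norm_num) (by norm_num)
    (by norm_num) d S hS A hA hApos hAroot hdeg hE

/-- `(2,9)`, `Z = 32`, `D = 4` (degree 36): letters `≤ 28` impossible; certificate `φ = 17/25`. [folklore] -/
theorem defectRow_9_32_4 (d : Fin 9 → ℕ) (S : Fin 9 → Matrix (Fin 2) (Fin 2) ℝ) (hS : ∀ l i j, |S l i j| ≤ 28)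
    (A : Finset ℝ) (hA : A.card = 32) (hApos : ∀ a ∈ A, 0 < a) (hAroot : ∀ a ∈ A, (pencil d S).det.IsRoot a)
    (hdeg : (pencil d S).det.natDegree = 36)
    (hE : 1 ≤ |(pencil d S).det.coeff 0 * (pencil d S).det.leadingCoeff|) : False :=
  row2 (K := 9) (Z := 32) (D := 4) (by norm_num) (17/25) 28 (by norm_num) (by norm_num)
    (by norm_num) d S hS A hA hApos hAroot hdeg hE

/-- `(2,9)`, `Z = 32`, `D = 5` (degree 37): letters `≤ 5` impossible; certificate `φ = 19/25`. [folklore] -/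
theorem defectRow_9_32_5 (d : Fin 9 → ℕ) (S : Fin 9 → Matrix (Fin 2) (Fin 2) ℝ) (hS : ∀ l i j, |S l i j| ≤ 5)
    (A : Finset ℝ) (hA : A.card = 32) (hApos : ∀ a ∈ A, 0 < a) (hAroot : ∀ a ∈ A, (pencil d S).det.IsRoot a)
    (hdeg : (pencil d S).det.natDegree = 37)
    (hE : 1 ≤ |(pencil d S).det.coeff 0 * (pencil d S).det.leadingCoeff|) : False :=
  row2 (K := 9) (Z := 32) (D := 5) (by norm_num) (19/25) 5 (by norm_num) (by norm_num)
    (by norm_num) d S hS A hA hApos hAroot hdeg hE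

/-! ### Rows at `(2,6)`, `Z = 16 = n(2,5)` (full: ≥ 31) and `(2,7)`, `Z = 20` (full: ≥ 104). -/

/-- `(2,6)`, `Z = 16`, `D = 1` (degree 17): letters `≤ 13` impossible; certificate `φ = 19/40`. [folklore] -/
theorem defectRow_6_16_1 (d : Fin 6 → ℕ) (S : Fin 6 → Matrix (Fin 2) (Fin 2) ℝ) (hS : ∀ l i j, |S l i j| ≤ 13)
    (A : Finset ℝ) (hA : A.card = 16) (hApos : ∀ a ∈ A, 0 < a) (hAroot : ∀ a ∈ A, (pencil d S).det.IsRoot a)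
    (hdeg : (pencil d S).det.natDegree = 17)
    (hE : 1 ≤ |(pencil d S).det.coeff 0 * (pencil d S).det.leadingCoeff|) : False :=
  row2 (K := 6) (Z := 16) (D := 1) le_rfl (19/40) 13 (by norm_num) (by norm_num)
    (by norm_num) d S hS A hA hApos hAroot hdeg hE

/-- `(2,6)`, `Z = 16`, `D = 2` (degree 18): letters `≤ 4` impossible; certificate `φ = 27/40`. [folklore] -/
theorem defectRow_6_16_2 (d : Fin 6 → ℕ) (S : Fin 6 → Matrix (Fin 2) (Fin 2) ℝ) (hS : ∀ l i j, |S l i j| ≤ 4)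
    (A : Finset ℝ) (hA : A.card = 16) (hApos : ∀ a ∈ A, 0 < a) (hAroot : ∀ a ∈ A, (pencil d S).det.IsRoot a)
    (hdeg : (pencil d S).det.natDegree = 18)
    (hE : 1 ≤ |(pencil d S).det.coeff 0 * (pencil d S).det.leadingCoeff|) : False :=
  row2 (K := 6) (Z := 16) (D := 2) (by norm_num) (27/40) 4 (by norm_num) (by norm_num)
    (by norm_num) d S hS A hA hApos hAroot hdeg hE

/-- `(2,7)`, `Z = 20`, `D = 1` (degree 21): letters `≤ 44` impossible; certificate `φ = 17/40`. [folklore] -/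
theorem defectRow_7_20_1 (d : Fin 7 → ℕ) (S : Fin 7 → Matrix (Fin 2) (Fin 2) ℝ) (hS : ∀ l i j, |S l i j| ≤ 44)
    (A : Finset ℝ) (hA : A.card = 20) (hApos : ∀ a ∈ A, 0 < a) (hAroot : ∀ a ∈ A, (pencil d S).det.IsRoot a)
    (hdeg : (pencil d S).det.natDegree = 21)
    (hE : 1 ≤ |(pencil d S).det.coeff 0 * (pencil d S).det.leadingCoeff|) : False :=
  row2 (K := 7) (Z := 20) (D := 1) le_rfl (17/40) 44 (by norm_num) (by norm_num)
    (by norm_num) d S hS A hA hApos hAroot hdeg hE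

/-- `(2,7)`, `Z = 20`, `D = 2` (degree 22): letters `≤ 13` impossible; certificate `φ = 3/5`. [folklore] -/
theorem defectRow_7_20_2 (d : Fin 7 → ℕ) (S : Fin 7 → Matrix (Fin 2) (Fin 2) ℝ) (hS : ∀ l i j, |S l i j| ≤ 13)
    (A : Finset ℝ) (hA : A.card = 20) (hApos : ∀ a ∈ A, 0 < a) (hAroot : ∀ a ∈ A, (pencil d S).det.IsRoot a)
    (hdeg : (pencil d S).det.natDegree = 22)
    (hE : 1 ≤ |(pencil d S).det.coeff 0 * (pencil d S).det.leadingCoeff|) : False :=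
  row2 (K := 7) (Z := 20) (D := 2) (by norm_num) (3/5) 13 (by norm_num) (by norm_num)
    (by norm_num) d S hS A hA hApos hAroot hdeg hE

/-! ## §7 The EXCESS LAW (pigeonhole constant; the optimal constant is STUB 2 `…DefectDefs.CapacityDefectLaw`) -/

/-- **EXCESS LAW (pigeonhole constant).**  For every real `f ≠ 0`, any finset `A` of `Z` distinct positive roots and
defect `D ≥ 1`:  `√|c₀·lc| · √2^Z · (√2·D)^{−D} ≤ ‖f‖₁`, i.e. `Z ≤ 2·log₂(‖f‖₁/√|c₀lc|) + D·(1 + 2·log₂ D)`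
(the `φ = π/2` specialisation of `defectLaw` with Jordan's `sin x ≥ (2/π)x`). [folklore] -/
theorem excessLaw (f : ℝ[X]) (hf : f ≠ 0) (A : Finset ℝ) (hApos : ∀ a ∈ A, 0 < a)
    (hAroot : ∀ a ∈ A, f.IsRoot a) {D : ℕ} (hD : f.natDegree = A.card + D) (hD1 : 1 ≤ D) :
    Real.sqrt |f.coeff 0 * f.leadingCoeff| * (Real.sqrt 2 ^ A.card * (1 / (Real.sqrt 2 * D)) ^ D) ≤ l1 f := by
  have hD' : (0 : ℝ) < D := by exact_mod_cast hD1
  have h := defectLaw f hf A hApos hAroot hD hD1 (φ := Real.pi / 2) (by positivity) le_rfl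
  have hcos : 2 * Real.cos (Real.pi / 2 / 2) = Real.sqrt 2 := by
    rw [show Real.pi / 2 / 2 = Real.pi / 4 by ring, Real.cos_pi_div_four]; ring
  have hsin : 1 / (Real.sqrt 2 * D) ≤ Real.sin (Real.pi / 2 / D) / Real.sqrt 2 := by
    have h1 : 2 / Real.pi * (Real.pi / 2 / D) ≤ Real.sin (Real.pi / 2 / D) :=
      Real.mul_le_sin (by positivity)
        (by calc Real.pi / 2 / D ≤ Real.pi / 2 / 1 :=
                div_le_div_of_nonneg_left (by positivity) one_pos (by exact_mod_cast hD1)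
              _ = Real.pi / 2 := by rw [div_one])
    have h2 : 2 / Real.pi * (Real.pi / 2 / D) = 1 / D := by field_simp
    rw [h2] at h1
    calc 1 / (Real.sqrt 2 * D) = (1 / D) / Real.sqrt 2 := by field_simp
      _ ≤ Real.sin (Real.pi / 2 / D) / Real.sqrt 2 := div_le_div_of_nonneg_right h1 (by positivity)
  rw [hcos] at h
  refine le_trans ?_ h
  refine mul_le_mul_of_nonneg_left (mul_le_mul_of_nonneg_left ?_ (by positivity)) (Real.sqrt_nonneg _)
  exact pow_le_pow_left₀ (by positivity) hsin D

end Summit.ValiantsHypothesis.ValiantsHypothesis.Theorems.LacunarySymmetroidMatrixDescartes.Defect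

end
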